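import Summits.ABC.StewartYu.PadicG3TwoOfData
import Summits.ABC.StewartYu.PadicMultiquadraticLiouville
import HarnessLib

/-!
# Cell abc-stewartyu, Gen-3 frame at `p = 2` (crux `Y07Two`, stmt-ABC-19659), layer F7c: the NEGATED BOUND as
# the frame's smallness input — `‖Λ₀‖₂ ≤ |b_θ|·2^{−U}` when `ord₂(∏ αⱼ^{bⱼ} − 1) ≥ U`

`Summits/ABC/StewartYu/PadicG3TwoNegBound.lean` — cell `abc-stewartyu` (HOME `run/shared/lean/pub/abc-stewartyu/`),
route `PadicPrimesKummerThird`, seat p3 (g5), F-two LEAD.  Theorems on `TwoSetup` and on `TwoSetup.ofData`.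

`FrameTwoLast C d` hands the frame the NEGATED bound `¬ ord₂(∏ αⱼ^{bⱼ} − 1) ≤ C(d+1)·∏V·(W + log 2Vmax)`.
Every smallness hypothesis of the frame layers is stated through `‖Λ₀‖` (`hslab` via
`PadicG3TwoSlabClass.exists_slabTwo`, the `f − φ` comparison, the k-step's first branch
`Bw·‖Λ₀‖·2ᵗ·2^{condExp}`).  The link: for any `TwoSetup`, `‖Λ‖ = ‖Θ − 1‖₂` (lit, `norm_Λ`) and
`Λ = −b_θ·Λ₀`, so `‖Λ₀‖ = ‖Θ − 1‖₂/‖b_θ‖₂ ≤ |b_θ|·‖Θ − 1‖₂` (`norm_Λ₀_le_abs_mul`); and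
`U ≤ ord₂(Θ − 1) ⇒ ‖Θ − 1‖₂ ≤ 2^{−U}` (`norm_Θ_sub_one_le_of_le`).  For the set-up built from pivot-last data,
`Θ = ∏ⱼ αⱼ^{bⱼ}` (`ofData_Θ`), so the negated bound gives `‖Λ₀‖ ≤ |b (last)|·2^{−U}` for every natural
`U ≤ C(d+1)·∏V·(W + log 2Vmax)` (`norm_Λ₀_ofData_le_of_not_le`).

WHAT THIS IS NOT: no parameter choice; no crux moves.

References: K. Yu, Compositio Math. 74 (1990), §1.1; K. Yu, Acta Math. 211 (2013), Lemma 5.1, (5.19).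
-/

noncomputable section

open Finset NormedSpace
open Literature.NumberTheory.Transcendental

namespace Summit.ABC.StewartYu

namespace TwoSetup

variable (S : TwoSetup)

/-- **`‖Λ₀‖ ≤ |b_θ|·‖Θ − 1‖₂`** (`‖Λ‖ = ‖b_θ‖₂‖Λ₀‖ = ‖Θ − 1‖₂`, `‖b_θ‖₂ ≥ 1/|b_θ|`). [cite: Yu1990, §1.1] -/
theorem norm_Λ₀_le_abs_mul : ‖S.Λ₀‖ ≤ |(S.bθ : ℝ)| * ‖(S.Θ : ℚ_[2]) - 1‖ := by
  have h1 : ‖(S.bθ : ℚ_[2])‖ * ‖S.Λ₀‖ = ‖(S.Θ : ℚ_[2]) - 1‖ := by rw [← S.norm_Λ_eq_mul, S.norm_Λ]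
  have hb : 1 / |(S.bθ : ℝ)| ≤ ‖(S.bθ : ℚ_[2])‖ := Multiquad.inv_abs_le_norm_intCast S.bθ_ne
  have habs : (0 : ℝ) < |(S.bθ : ℝ)| := abs_pos.mpr (by exact_mod_cast S.bθ_ne)
  have h0 : 0 ≤ ‖S.Λ₀‖ := norm_nonneg _
  -- `‖Λ₀‖ = ‖Θ-1‖/‖bθ‖ ≤ ‖Θ-1‖·|bθ|`
  have h2 : ‖S.Λ₀‖ * (1 / |(S.bθ : ℝ)|) ≤ ‖S.Λ₀‖ * ‖(S.bθ : ℚ_[2])‖ :=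
    mul_le_mul_of_nonneg_left hb h0
  have h3 : ‖S.Λ₀‖ * ‖(S.bθ : ℚ_[2])‖ = ‖(S.Θ : ℚ_[2]) - 1‖ := by rw [mul_comm]; exact h1
  rw [h3] at h2
  have h4 : ‖S.Λ₀‖ = ‖S.Λ₀‖ * (1 / |(S.bθ : ℝ)|) * |(S.bθ : ℝ)| := by
    field_simp
  rw [h4]
  calc ‖S.Λ₀‖ * (1 / |(S.bθ : ℝ)|) * |(S.bθ : ℝ)| ≤ ‖(S.Θ : ℚ_[2]) - 1‖ * |(S.bθ : ℝ)| :=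
        mul_le_mul_of_nonneg_right h2 habs.le
    _ = |(S.bθ : ℝ)| * ‖(S.Θ : ℚ_[2]) - 1‖ := mul_comm _ _

/-- `U ≤ ord₂(Θ − 1) ⇒ ‖Θ − 1‖₂ ≤ 2^{−U}` (`Θ ≠ 1`). [folklore] -/
theorem norm_Θ_sub_one_le_of_le (hΘ : S.Θ ≠ 1) {U : ℤ} (hU : U ≤ padicValRat 2 (S.Θ - 1)) :
    ‖(S.Θ : ℚ_[2]) - 1‖ ≤ ((2 : ℕ) : ℝ) ^ (-U) := by
  haveI : Fact (Nat.Prime 2) := ⟨Nat.prime_two⟩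
  exact TwoAdic.norm_ratCast_sub_one_le_zpow (p := 2) hΘ hU

/-- **`‖Λ₀‖ ≤ |b_θ|·2^{−U}`** when `U ≤ ord₂(Θ − 1)` and `Θ ≠ 1`. [cite: Yu2013, Lemma 5.1; shape only] -/
theorem norm_Λ₀_le_of_le (hΘ : S.Θ ≠ 1) {U : ℤ} (hU : U ≤ padicValRat 2 (S.Θ - 1)) :
    ‖S.Λ₀‖ ≤ |(S.bθ : ℝ)| * ((2 : ℕ) : ℝ) ^ (-U) :=
  (S.norm_Λ₀_le_abs_mul).trans (mul_le_mul_of_nonneg_left (S.norm_Θ_sub_one_le_of_le hΘ hU) (abs_nonneg _))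

/-! ### On the set-up built from pivot-last data -/

variable {d : ℕ} (α : Fin (d + 1) → ℚ) (b : Fin (d + 1) → ℤ)
  (hα : ∀ j, 3 ≤ padicValRat 2 (α j - 1)) (hb : b (Fin.last d) ≠ 0)
  (hmin : ∀ j, b j ≠ 0 → padicValInt 2 (b (Fin.last d)) ≤ padicValInt 2 (b j))

/-- `Θ(ofData) = ∏ⱼ αⱼ^{bⱼ}` over all `d + 1` indices. [folklore] -/
theorem ofData_Θ : (ofData d α b hα hb hmin).Θ = ∏ j : Fin (d + 1), α j ^ b j := by
  unfold Θ ofData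
  rw [Fin.prod_univ_castSucc]

/-- **THE NEGATED BOUND AS THE FRAME'S SMALLNESS INPUT**: for independent data with `b ≠ 0` (so
`∏ αⱼ^{bⱼ} ≠ 1`), if `¬ ord₂(∏ αⱼ^{bⱼ} − 1) ≤ T` for a real threshold `T`, then for every natural `U ≤ T`:
`‖Λ₀(ofData)‖ ≤ |b (last)|·2^{−U}`. [cite: Yu2013, (5.19) and Lemma 5.1; shape only] -/
theorem norm_Λ₀_ofData_le_of_not_le
    (hind : ∀ μ : Fin (d + 1) → ℤ, ∏ j, α j ^ μ j = 1 → μ = 0) (hb0 : b ≠ 0)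
    {T : ℝ} (hneg : ¬ (padicValRat 2 (∏ j, α j ^ b j - 1) : ℝ) ≤ T) {U : ℕ} (hUT : (U : ℝ) ≤ T) :
    ‖(ofData d α b hα hb hmin).Λ₀‖ ≤ |(b (Fin.last d) : ℝ)| * ((2 : ℕ) : ℝ) ^ (-(U : ℤ)) := by
  have hΘ : (ofData d α b hα hb hmin).Θ ≠ 1 := by
    rw [ofData_Θ]
    intro h1
    exact hb0 (hind b h1)
  have hU : (U : ℤ) ≤ padicValRat 2 ((ofData d α b hα hb hmin).Θ - 1) := by
    rw [ofData_Θ]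
    push Not at hneg
    have : (U : ℝ) < (padicValRat 2 (∏ j, α j ^ b j - 1) : ℝ) := lt_of_le_of_lt hUT hneg
    exact_mod_cast this.le
  have h := (ofData d α b hα hb hmin).norm_Λ₀_le_of_le hΘ hU
  exact h

end TwoSetup

end Summit.ABC.StewartYu

end
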